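import Summits.BirchSwinnertonDyer.BirchSwinnertonDyer.Theorems.QuadraticBranchSignedControlPlusEtaNonsurjCMAnchorTransfer
import Summits.BirchSwinnertonDyer.BirchSwinnertonDyer.Theorems.QuadraticBranchSignedControlPlusEtaNonsurjCorpuzLeiTransferOPEN
import Summits.BirchSwinnertonDyer.BirchSwinnertonDyer.Theorems.QuadraticBranchSignedControlPlusEtaNonsurjModFiveCongruenceRecordsB
import Summits.BirchSwinnertonDyer.BirchSwinnertonDyer.Theorems.QuadraticBranchSignedControlPlusEtaNonsurjModFiveCongruenceRecordsC
import Summits.BirchSwinnertonDyer.BirchSwinnertonDyer.Theorems.QuadraticBranchSignedControlPlusEtaNonsurjModFiveCongruenceRecordsD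
import Summits.BirchSwinnertonDyer.BirchSwinnertonDyer.Theorems.QuadraticBranchSignedControlPlusEtaNonsurjFineRoadRecordsC
import Summits.BirchSwinnertonDyer.BirchSwinnertonDyer.Theorems.QuadraticBranchSignedControlPlusEtaNonsurjFineRoadRecordsD
import Summits.BirchSwinnertonDyer.BirchSwinnertonDyer.Theorems.QuadraticBranchSignedControlPlusEtaNonsurjFineRoadRecordsE
import Summits.BirchSwinnertonDyer.BirchSwinnertonDyer.Theorems.QuadraticBranchSignedControlPlusEtaNonsurjPrimeLFunctionRecordsA
import Summits.BirchSwinnertonDyer.BirchSwinnertonDyer.Theorems.QuadraticBranchSignedControlPlusEtaNonsurjPrimeLFunctionRecordsB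
import Summits.BirchSwinnertonDyer.BirchSwinnertonDyer.Theorems.QuadraticBranchSignedControlPlusEtaNonsurjCMAnchorTransferRecordsA
import HarnessLib

/-!
# Route `QuadraticBranchSignedControl` (rung K8, cell `bsd-potss`), residual crux `PlusEtaMainConjectureNonsurj`
# (stmt-BirchSwinnertonDyer-19606): the CM-UNIT-ANCHOR TRANSFER RECORDS — (C1⁺_η) at `p = 5` per row for the NON-CM rows of
# the crux below `5·10⁵`, part E: the last 2 rank-1 rows + the 2 rank-2 rows (a `--supports` file; seat `bsd-potss-k8eta-c2` g8; nothing booked, BSD is not proved by any of this)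

WHAT. Crux 19606 has 30 non-CM rows below `5·10⁵` (all `p = 5`, image `C_ns⁺(5)`; 12 of rank 0, 16 of rank 1, 2 of rank 2;
HOME/k8eta-c2/g3/nononto_rows.tsv). EVERY one of them is `5`-congruent to a CM UNIT ANCHOR `A` (CM, `r_an = 0`, `#Ш_an = 1`,
`5 ∤ Tam(A)`: `900b1`, `3600bb1`, `10800cj1`, `11025e1`, `14400cz1`, or the unit siblings `[0,0,0,0,−675]`, `[0,0,1,0,−169]`,
`[0,0,0,0,800]`, `[0,0,1,0,−405169]`), by an explicit point of one of Fisher's Hesse families — this seat's census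
`pub/bsd-potss/k8eta-c2/g8/K8-CM-UNIT-ANCHORS-k8eta-c2-g8.tsv` (30/30) and kernel records `EtaModFiveCongruenceRecords.modPCongruent_twist5_*`
(parts B/C/D; conditional on Fisher's published Thm. 13.2 / Thm. 5.8 only). THIS FILE instantiates the CM-unit-anchor transfer
road `EtaCMAnchorTransfer.quadraticBranchPlusEtaMainConjectureAt_of_cmUnitAnchor_of_transferFrame` per row: Kobayashi's even
main conjecture at `η` for every good `a_5 = 0` globally minimal model `V` of the row's `5`-twist, GIVEN a good `a_5 = 0` globally
minimal model `V′` of the anchor's `5`-twist, MODULO the OPEN binder `hCL` (`CorpuzLei2025_etaPlusMainConjecture_transfer_OPEN`; Corpuz–Lei arXiv:2508.09733 Thms 1–3 at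
`i = (p−1)/2` — PREPRINT, `[claim: …, status: under-review]`), the named facts modularity / GZK / Burungale–Flach bsd.S28 /
one Fisher fact, and per row ONLY the anchor's displayed `L(A,1) ≠ 0`, `#Ш(A)_an = 1`, `5 ∤ Tam(A)`. In particular the four rows
where the Eisenstein stub `stub_etaMC_nonCM_lower` kept open content in-table after g7 — `242325g1`, `404325g1` (rank 1, non-prime
`L_5⁺`) and `162675m1`, `242325h1` (rank 2) — are settled in shape here exactly like the others.

HONEST FRAMING (cell `bsd-potss`; HUMAN RULING D-0036/D-0074): BOOKKEEPING THEOREMS ONLY — no definition, no new fact, no `sorry`,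
axioms standard; CONDITIONAL on `hCL` (an unrefereed preprint read through the flagged dictionary `CL25-eta-plus-dictionary`) and
on the named facts in hypothesis position. 19606 stays OPEN (CM rows; class-wide the non-CM rows without a CM unit anchor; the
binder is PRE); no stub is proved by name; nothing is booked; BSD(W,5) is claimed for no pair; no label / mark / count moves.
`--supports stmt-BirchSwinnertonDyer-19606`.

References: [CorpuzLei2025] Thms 1–3 (claim; hypothesis only); [GreenbergVatsal2000] Thm. (1.4); [Kobayashi2003] §4 (p. 8);
[BurungaleFlach2024] Thm. 1.1, Cor. 2; [Fisher2012Hessian] Thm. 13.2; [Fisher2013TwistsOfX5] Thm. 5.8; [Cremona1997] Table 1.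
-/

set_option autoImplicit false
set_option linter.dupNamespace false

noncomputable section

open scoped Classical

open CongruenceSubgroup Field Function NumberField IsDedekindDomain WeierstrassCurve
open Literature.NumberTheory.EllipticCurves
open Literature.NumberTheory.EllipticCurves.ModularForms
open Literature.NumberTheory.EllipticCurves.Rank1Residual
open Literature.NumberTheory.EllipticCurves.Rank1Residual.Typed
open Literature.NumberTheory.GaloisRepresentations
open Literature.NumberTheory.GaloisCohomology
open Literature.NumberTheory.EllipticCurves.IwasawaAlgebra
open Literature.NumberTheory.EllipticCurves.IwasawaDual ZpExtension
open Literature.NumberTheory.EllipticCurves.GreenbergVatsal2000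
open Literature.NumberTheory.EllipticCurves.HesseFamilyFive (thm132_geomTorsionFive_of_hesseFamily
  thm58_geomTorsionFive_of_dualHesseFamily)
open Summit.BirchSwinnertonDyer.Rank1Residual.X11b.Levels
open Summit.BirchSwinnertonDyer.Rank1Residual.X11b
open Summit.BirchSwinnertonDyer.Rank1Residual.Additive
open Summit.BirchSwinnertonDyer.Rank1Residual.Additive.SignedTwist
open scoped ContRepresentation
open Summit.BirchSwinnertonDyer.Rank1Residual.AdditivePotMult
open Summit.BirchSwinnertonDyer.Rank1Residual.O6 (ModPCongruent)

namespace Summit.BirchSwinnertonDyer.BirchSwinnertonDyer.Theorems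

namespace EtaCMAnchorTransferRecords

set_option maxRecDepth 100000 in
/-- **(C1⁺_η) at `p = 5` for every good `a_5 = 0` globally minimal model `V` of the `5`-twist of `417600ke1`**
(`[0, 0, 0, -310500, 139239000]`; non-CM, `Im ρ̄ = C_ns⁺(5)`, rank `1`; Cremona: `Tam = 20`, `#Ш_an = 1`) BY THE CM-UNIT-ANCHOR
TRANSFER ROAD: the row is `5`-congruent to `14400cz1` = `[0,0,0,0,−1000]` (CM, `r_an = 0`, `#Ш_an = 1`, `Tam = 4`; displayed
`hLA hm htam`) — on the twist side the congruence `V′[5] ≃ V[5]` for ALL models is the kernel record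
`EtaModFiveCongruenceRecords.modPCongruent_twist5_14400cz1_417600ke1` (the twisted row is the point `(λ:μ) = (600 : 1)` of the
DIRECT Hesse family of the twisted anchor), conditional on Fisher's `thm132_geomTorsionFive_of_hesseFamily` only; at the
anchor's twist (C1⁺_η) and `μ = 0` are TREE THEOREMS (`EtaUnitRows`, `EtaMuBound`; mod `hmod hGZK hS28`); the transfer is the
OPEN binder `hCL` (Corpuz–Lei 2025 Thms 1–3 at `i = (p−1)/2`, PREPRINT). NO hypothesis on the row beyond its model: no rank, no
`L`-value, no shape of `L_5⁺`, no analytic `μ`, no Kobayashi Thm. 2.2/4.1, no Hatley–Lei, no Poitou–Tate, no Kitajima–Otsuki, no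
(A), no `L₀`. Per-row instance of `EtaCMAnchorTransfer.quadraticBranchPlusEtaMainConjectureAt_of_cmUnitAnchor_of_transferFrame`;
CONDITIONAL on `hCL` (PRE) and the named facts; nothing booked; BSD(W,5) claimed for no pair.
[claim: CorpuzLei2025, status: under-review] [cite: Fisher2012Hessian, Thm. 13.2 (i)]
[cite: Kobayashi2003, §4 Even main conjecture (p. 8)] [cite: GreenbergVatsal2000, Thm. (1.4)]
[cite: BurungaleFlach2024, Thm. 1.1 and Cor. 2] [cite: Cremona1997, Table 1 (label 417600ke1)] -/
theorem etaMC_417600ke1_5_cmAnchorTransfer (hCL : CorpuzLei2025_etaPlusMainConjecture_transfer_OPEN)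
    (hmod : hasEntireLFunction_rat) (hGZK : rank_eq_analyticRank_of_analyticRank_le_one)
    (hS28 : bsdTriple_of_hasCM_of_L_one_ne_zero) (hF : thm132_geomTorsionFive_of_hesseFamily)
    (W : WeierstrassCurve ℚ) (hW : W = ⟨0, 0, 0, (-310500), 139239000⟩) (A : WeierstrassCurve ℚ) (hA : A = ⟨0, 0, 0, 0, (-1000)⟩)
    (hLA : A.entireLFunction 1 ≠ 0) (hm : shaAn A = ((1 : ℕ) : ℂ)) (htam : ¬ 5 ∣ A.tamagawaProduct) :
    ∀ (V' : WeierstrassCurve ℚ) [V'.IsElliptic] [V'.IsGloballyMinimal]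
      (V : WeierstrassCurve ℚ) [V.IsElliptic] [V.IsGloballyMinimal] [Fact (5 : ℕ).Prime],
      (∃ C' : VariableChange ℚ, C' • A.quadraticTwist (5) = V') →
      V'.HasGoodReductionAtPrime 5 → V'.frobeniusTrace 5 = 0 →
      (∃ C : VariableChange ℚ, C • W.quadraticTwist (5) = V) →
      V.HasGoodReductionAtPrime 5 → V.frobeniusTrace 5 = 0 →
      QuadraticBranchPlusEtaMainConjectureAt V 5 := by
  intro V' _ _ V _ _ _ hC' hgood' hap' hC hgood hap
  subst hW; subst hA
  haveI := EtaCMUnitRecords.isElliptic_14400cz1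
  haveI := EtaCMUnitRecords.isGloballyMinimal_14400cz1
  haveI := EtaPrimeRoadRecords.isElliptic_417600ke1
  have hcong : ModPCongruent V' V 5 :=
    EtaModFiveCongruenceRecords.modPCongruent_twist5_14400cz1_417600ke1 hF _ _ rfl rfl V' V hC' hC
  obtain ⟨C', hC'V'⟩ := hC'
  have hD : ((-1 : ℚ) ^ ((5 : ℕ) / 2) * ((5 : ℕ) : ℚ)) = 5 := by norm_num
  exact EtaCMAnchorTransfer.quadraticBranchPlusEtaMainConjectureAt_of_cmUnitAnchor_of_transferFrame 5 hCL hmod hGZK hS28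
    (le_refl 5) _ hasCM_14400cz1 hLA ⟨1, by exact_mod_cast hm, by simp⟩ htam V' C' (by rw [hD]; exact hC'V') hgood' hap' V hgood
    hap hcong

set_option maxRecDepth 100000 in
/-- **(C1⁺_η) at `p = 5` for every good `a_5 = 0` globally minimal model `V` of the `5`-twist of `458100j1`**
(`[0, 0, 0, -213033375, 1194190269750]`; non-CM, `Im ρ̄ = C_ns⁺(5)`, rank `1`; Cremona: `Tam = 20`, `#Ш_an = 1`) BY THE
CM-UNIT-ANCHOR TRANSFER ROAD: the row is `5`-congruent to `900b1` = `[0,0,0,0,125]` (CM, `r_an = 0`, `#Ш_an = 1`, `Tam = 4`;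
displayed `hLA hm htam`) — on the twist side the congruence `V′[5] ≃ V[5]` for ALL models is the kernel record
`EtaModFiveCongruenceRecords.modPCongruent_twist5_900b1_458100j1` (the twisted row is the point `(λ:μ) = (300 : 1)` of the
INDIRECT Hesse family of the twisted anchor), conditional on Fisher's `thm58_geomTorsionFive_of_dualHesseFamily` only; at the
anchor's twist (C1⁺_η) and `μ = 0` are TREE THEOREMS (`EtaUnitRows`, `EtaMuBound`; mod `hmod hGZK hS28`); the transfer is the
OPEN binder `hCL` (Corpuz–Lei 2025 Thms 1–3 at `i = (p−1)/2`, PREPRINT). NO hypothesis on the row beyond its model: no rank, no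
`L`-value, no shape of `L_5⁺`, no analytic `μ`, no Kobayashi Thm. 2.2/4.1, no Hatley–Lei, no Poitou–Tate, no Kitajima–Otsuki, no
(A), no `L₀`. Per-row instance of `EtaCMAnchorTransfer.quadraticBranchPlusEtaMainConjectureAt_of_cmUnitAnchor_of_transferFrame`;
CONDITIONAL on `hCL` (PRE) and the named facts; nothing booked; BSD(W,5) claimed for no pair.
[claim: CorpuzLei2025, status: under-review] [cite: Fisher2013TwistsOfX5, Thm. 5.8]
[cite: Kobayashi2003, §4 Even main conjecture (p. 8)] [cite: GreenbergVatsal2000, Thm. (1.4)]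
[cite: BurungaleFlach2024, Thm. 1.1 and Cor. 2] [cite: Cremona1997, Table 1 (label 458100j1)] -/
theorem etaMC_458100j1_5_cmAnchorTransfer (hCL : CorpuzLei2025_etaPlusMainConjecture_transfer_OPEN)
    (hmod : hasEntireLFunction_rat) (hGZK : rank_eq_analyticRank_of_analyticRank_le_one)
    (hS28 : bsdTriple_of_hasCM_of_L_one_ne_zero) (hF : thm58_geomTorsionFive_of_dualHesseFamily)
    (W : WeierstrassCurve ℚ) (hW : W = ⟨0, 0, 0, (-213033375), 1194190269750⟩) (A : WeierstrassCurve ℚ) (hA : A = ⟨0, 0, 0, 0, 125⟩)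
    (hLA : A.entireLFunction 1 ≠ 0) (hm : shaAn A = ((1 : ℕ) : ℂ)) (htam : ¬ 5 ∣ A.tamagawaProduct) :
    ∀ (V' : WeierstrassCurve ℚ) [V'.IsElliptic] [V'.IsGloballyMinimal]
      (V : WeierstrassCurve ℚ) [V.IsElliptic] [V.IsGloballyMinimal] [Fact (5 : ℕ).Prime],
      (∃ C' : VariableChange ℚ, C' • A.quadraticTwist (5) = V') →
      V'.HasGoodReductionAtPrime 5 → V'.frobeniusTrace 5 = 0 →
      (∃ C : VariableChange ℚ, C • W.quadraticTwist (5) = V) →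
      V.HasGoodReductionAtPrime 5 → V.frobeniusTrace 5 = 0 →
      QuadraticBranchPlusEtaMainConjectureAt V 5 := by
  intro V' _ _ V _ _ _ hC' hgood' hap' hC hgood hap
  subst hW; subst hA
  haveI := EtaCMUnitRecords.isElliptic_900b1
  haveI := EtaCMUnitRecords.isGloballyMinimal_900b1
  haveI := EtaPrimeRoadRecords.isElliptic_458100j1
  have hcong : ModPCongruent V' V 5 :=
    EtaModFiveCongruenceRecords.modPCongruent_twist5_900b1_458100j1 hF _ _ rfl rfl V' V hC' hC
  obtain ⟨C', hC'V'⟩ := hC'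
  have hD : ((-1 : ℚ) ^ ((5 : ℕ) / 2) * ((5 : ℕ) : ℚ)) = 5 := by norm_num
  exact EtaCMAnchorTransfer.quadraticBranchPlusEtaMainConjectureAt_of_cmUnitAnchor_of_transferFrame 5 hCL hmod hGZK hS28
    (le_refl 5) _ hasCM_900b1 hLA ⟨1, by exact_mod_cast hm, by simp⟩ htam V' C' (by rw [hD]; exact hC'V') hgood' hap' V hgood
    hap hcong

set_option maxRecDepth 100000 in
/-- **(C1⁺_η) at `p = 5` for every good `a_5 = 0` globally minimal model `V` of the `5`-twist of `162675m1`**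
(`[0, 0, 1, -1152750, 483818656]`; non-CM, `Im ρ̄ = C_ns⁺(5)`, rank `2` (OUTSIDE the rank ≤ 1 programme — recorded because the
road is rank-free); Cremona: `Tam = 30`, `#Ш_an = 1`) BY THE CM-UNIT-ANCHOR TRANSFER ROAD: the row is `5`-congruent to the unit
sibling `A = [0,0,1,0,−169]` of the class of `675a1` (CM, `r_an = 0`, `#Ш_an = 1`, `Tam = 1`; displayed `hLA hm htam`) — on the
twist side the congruence `V′[5] ≃ V[5]` for ALL models is the kernel record
`EtaModFiveCongruenceRecords.modPCongruent_twist5_A675_162675m1` (the twisted row is the point `(λ:μ) = (450 : 1)` of the DIRECT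
Hesse family of the twisted anchor), conditional on Fisher's `thm132_geomTorsionFive_of_hesseFamily` only; at the anchor's twist
(C1⁺_η) and `μ = 0` are TREE THEOREMS (`EtaUnitRows`, `EtaMuBound`; mod `hmod hGZK hS28`); the transfer is the OPEN binder `hCL`
(Corpuz–Lei 2025 Thms 1–3 at `i = (p−1)/2`, PREPRINT). NO hypothesis on the row beyond its model: no rank, no `L`-value, no
shape of `L_5⁺`, no analytic `μ`, no Kobayashi Thm. 2.2/4.1, no Hatley–Lei, no Poitou–Tate, no Kitajima–Otsuki, no (A), no `L₀`.
Per-row instance of `EtaCMAnchorTransfer.quadraticBranchPlusEtaMainConjectureAt_of_cmUnitAnchor_of_transferFrame`; CONDITIONAL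
on `hCL` (PRE) and the named facts; nothing booked; BSD(W,5) claimed for no pair. [claim: CorpuzLei2025, status: under-review]
[cite: Fisher2012Hessian, Thm. 13.2 (i)] [cite: Kobayashi2003, §4 Even main conjecture (p. 8)]
[cite: GreenbergVatsal2000, Thm. (1.4)] [cite: BurungaleFlach2024, Thm. 1.1 and Cor. 2]
[cite: Cremona1997, Table 1 (label 162675m1)] -/
theorem etaMC_162675m1_5_cmAnchorTransfer (hCL : CorpuzLei2025_etaPlusMainConjecture_transfer_OPEN)
    (hmod : hasEntireLFunction_rat) (hGZK : rank_eq_analyticRank_of_analyticRank_le_one)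
    (hS28 : bsdTriple_of_hasCM_of_L_one_ne_zero) (hF : thm132_geomTorsionFive_of_hesseFamily)
    (W : WeierstrassCurve ℚ) (hW : W = ⟨0, 0, 1, (-1152750), 483818656⟩) (A : WeierstrassCurve ℚ) (hA : A = ⟨0, 0, 1, 0, (-169)⟩)
    (hLA : A.entireLFunction 1 ≠ 0) (hm : shaAn A = ((1 : ℕ) : ℂ)) (htam : ¬ 5 ∣ A.tamagawaProduct) :
    ∀ (V' : WeierstrassCurve ℚ) [V'.IsElliptic] [V'.IsGloballyMinimal]
      (V : WeierstrassCurve ℚ) [V.IsElliptic] [V.IsGloballyMinimal] [Fact (5 : ℕ).Prime],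
      (∃ C' : VariableChange ℚ, C' • A.quadraticTwist (5) = V') →
      V'.HasGoodReductionAtPrime 5 → V'.frobeniusTrace 5 = 0 →
      (∃ C : VariableChange ℚ, C • W.quadraticTwist (5) = V) →
      V.HasGoodReductionAtPrime 5 → V.frobeniusTrace 5 = 0 →
      QuadraticBranchPlusEtaMainConjectureAt V 5 := by
  intro V' _ _ V _ _ _ hC' hgood' hap' hC hgood hap
  subst hW; subst hA
  haveI := EtaFineRoadRecords.isElliptic_A675
  haveI := EtaFineRoadRecords.isGloballyMinimal_A675
  haveI := isElliptic_162675m1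
  have hcong : ModPCongruent V' V 5 :=
    EtaModFiveCongruenceRecords.modPCongruent_twist5_A675_162675m1 hF _ _ rfl rfl V' V hC' hC
  obtain ⟨C', hC'V'⟩ := hC'
  have hD : ((-1 : ℚ) ^ ((5 : ℕ) / 2) * ((5 : ℕ) : ℚ)) = 5 := by norm_num
  exact EtaCMAnchorTransfer.quadraticBranchPlusEtaMainConjectureAt_of_cmUnitAnchor_of_transferFrame 5 hCL hmod hGZK hS28
    (le_refl 5) _ EtaFineRoadRecords.hasCM_A675 hLA ⟨1, by exact_mod_cast hm, by simp⟩ htam V' C' (by rw [hD]; exact hC'V') hgood' hap' V hgood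
    hap hcong

set_option maxRecDepth 100000 in
/-- **(C1⁺_η) at `p = 5` for every good `a_5 = 0` globally minimal model `V` of the `5`-twist of `242325h1`**
(`[0, 0, 1, -3415500, 1287477281]`; non-CM, `Im ρ̄ = C_ns⁺(5)`, rank `2` (OUTSIDE the rank ≤ 1 programme — recorded because the
road is rank-free); Cremona: `Tam = 10`, `#Ш_an = 1`) BY THE CM-UNIT-ANCHOR TRANSFER ROAD: the row is `5`-congruent to the unit
sibling `A = [0,0,1,0,−169]` of the class of `675a1` (CM, `r_an = 0`, `#Ш_an = 1`, `Tam = 1`; displayed `hLA hm htam`) — on the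
twist side the congruence `V′[5] ≃ V[5]` for ALL models is the kernel record
`EtaModFiveCongruenceRecords.modPCongruent_twist5_A675_242325h1` (the twisted row is the point `(λ:μ) = (900 : 1)` of the DIRECT
Hesse family of the twisted anchor), conditional on Fisher's `thm132_geomTorsionFive_of_hesseFamily` only; at the anchor's twist
(C1⁺_η) and `μ = 0` are TREE THEOREMS (`EtaUnitRows`, `EtaMuBound`; mod `hmod hGZK hS28`); the transfer is the OPEN binder `hCL`
(Corpuz–Lei 2025 Thms 1–3 at `i = (p−1)/2`, PREPRINT). NO hypothesis on the row beyond its model: no rank, no `L`-value, no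
shape of `L_5⁺`, no analytic `μ`, no Kobayashi Thm. 2.2/4.1, no Hatley–Lei, no Poitou–Tate, no Kitajima–Otsuki, no (A), no `L₀`.
Per-row instance of `EtaCMAnchorTransfer.quadraticBranchPlusEtaMainConjectureAt_of_cmUnitAnchor_of_transferFrame`; CONDITIONAL
on `hCL` (PRE) and the named facts; nothing booked; BSD(W,5) claimed for no pair. [claim: CorpuzLei2025, status: under-review]
[cite: Fisher2012Hessian, Thm. 13.2 (i)] [cite: Kobayashi2003, §4 Even main conjecture (p. 8)]
[cite: GreenbergVatsal2000, Thm. (1.4)] [cite: BurungaleFlach2024, Thm. 1.1 and Cor. 2]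
[cite: Cremona1997, Table 1 (label 242325h1)] -/
theorem etaMC_242325h1_5_cmAnchorTransfer (hCL : CorpuzLei2025_etaPlusMainConjecture_transfer_OPEN)
    (hmod : hasEntireLFunction_rat) (hGZK : rank_eq_analyticRank_of_analyticRank_le_one)
    (hS28 : bsdTriple_of_hasCM_of_L_one_ne_zero) (hF : thm132_geomTorsionFive_of_hesseFamily)
    (W : WeierstrassCurve ℚ) (hW : W = ⟨0, 0, 1, (-3415500), 1287477281⟩) (A : WeierstrassCurve ℚ) (hA : A = ⟨0, 0, 1, 0, (-169)⟩)
    (hLA : A.entireLFunction 1 ≠ 0) (hm : shaAn A = ((1 : ℕ) : ℂ)) (htam : ¬ 5 ∣ A.tamagawaProduct) :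
    ∀ (V' : WeierstrassCurve ℚ) [V'.IsElliptic] [V'.IsGloballyMinimal]
      (V : WeierstrassCurve ℚ) [V.IsElliptic] [V.IsGloballyMinimal] [Fact (5 : ℕ).Prime],
      (∃ C' : VariableChange ℚ, C' • A.quadraticTwist (5) = V') →
      V'.HasGoodReductionAtPrime 5 → V'.frobeniusTrace 5 = 0 →
      (∃ C : VariableChange ℚ, C • W.quadraticTwist (5) = V) →
      V.HasGoodReductionAtPrime 5 → V.frobeniusTrace 5 = 0 →
      QuadraticBranchPlusEtaMainConjectureAt V 5 := by
  intro V' _ _ V _ _ _ hC' hgood' hap' hC hgood hap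
  subst hW; subst hA
  haveI := EtaFineRoadRecords.isElliptic_A675
  haveI := EtaFineRoadRecords.isGloballyMinimal_A675
  haveI := isElliptic_242325h1
  have hcong : ModPCongruent V' V 5 :=
    EtaModFiveCongruenceRecords.modPCongruent_twist5_A675_242325h1 hF _ _ rfl rfl V' V hC' hC
  obtain ⟨C', hC'V'⟩ := hC'
  have hD : ((-1 : ℚ) ^ ((5 : ℕ) / 2) * ((5 : ℕ) : ℚ)) = 5 := by norm_num
  exact EtaCMAnchorTransfer.quadraticBranchPlusEtaMainConjectureAt_of_cmUnitAnchor_of_transferFrame 5 hCL hmod hGZK hS28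
    (le_refl 5) _ EtaFineRoadRecords.hasCM_A675 hLA ⟨1, by exact_mod_cast hm, by simp⟩ htam V' C' (by rw [hD]; exact hC'V') hgood' hap' V hgood
    hap hcong

end EtaCMAnchorTransferRecords

end Summit.BirchSwinnertonDyer.BirchSwinnertonDyer.Theorems

end
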